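import Summits.AtomisticToContinuum.Crystallization.Theorems.HullExactificationCascadeZeroDefectDensityBctWitness
import HarnessLib

/-!
# A two-shell radially tight site that is not `1/20`-good — part 3: a FINITE configuration
# (route `HullExactificationCascade`, crux `ZeroDefectDensity`, stmt-AtomisticToContinuum-12086;
# line `registered`/`birth`)

Parts 1–2 exhibit the (infinite, periodic) bct witness set.  The registered stubs of the line quantify
over FINITE injective configurations `x : Fin N → ℝ³` (through `Set.range (x N)`), so this file cuts
the witness down to the finite chunk with labels in the box `[-4, 4]³` (even label sum) and checks
that the CENTRE is still radially tight two shells deep and still not `SiteGood`: every site within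
`13/5 · d` of the centre has its label in `[-3, 3]³`, and the nearest neighbour and the whole
`13/10 · d`-shell of such a site have labels in `[-4, 4]³`, so its local data in the chunk coincide
with its local data in the full lattice.  Registered sub-goal:
`exists_finite_twoShellTight_not_siteGood` (the two-shell predicate verbatim as registered, with
`Set.range (x N)` ↦ `Set.range x`, `x N i` ↦ `x i`).  No definitions, no notation.
-/

noncomputable section

namespace Summit.AtomisticToContinuum.Crystallization.Theorems.ZeroDefectDensityBirth

open Literature.Geometry.DiscreteGeometry

/-- The fcc minimal vectors have coordinates in `{-1, 0, 1}`. [folklore] -/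
theorem fccInt_coord_bound : ∀ w ∈ fccInt, ∀ i : Fin 3, -1 ≤ w i ∧ w i ≤ 1 := by decide

/-- For an integer `Q ≥ 0`: `√Q < 13/5 · √1250 → Q < 8450` (`(13/5)² · 1250 = 8450`). [folklore] -/
theorem lt_of_sqrt_lt_twoShell (Q : ℤ) (hQ : 0 ≤ Q) (h : Real.sqrt (Q : ℝ) < 13 / 5 * Real.sqrt 1250) :
    Q < 8450 := by
  have h13 : (13 / 5 : ℝ) * Real.sqrt 1250 = Real.sqrt ((13 / 5) ^ 2 * 1250) := by
    rw [Real.sqrt_mul (by norm_num), Real.sqrt_sq (by norm_num)]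
  rw [h13, Real.sqrt_lt_sqrt_iff (by exact_mod_cast hQ)] at h
  have h' : (Q : ℝ) < 8450 := h.trans_le (by norm_num)
  exact_mod_cast h'

/-- **Local data in the chunk = local data in the lattice.** For the site map `P` of the witness and
the finite chunk `F = P(box)`, `box` = even-sum labels in `[-4,4]³`: a site `P v` with label in
`[-3,3]³` has nearest-neighbour distance `√1250` in `F` and its strict `13/10 · √1250`-shell in `F` is
the full twelve-point shell `P(v + fccInt)`. [folklore] -/
theorem bct_chunk_local {P : (Fin 3 → ℤ) → EuclideanSpace ℝ (Fin 3)}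
    (hP : ∀ w, P w = intVec ![25 * w 0, 25 * w 1, 27 * w 2])
    {F : Set (EuclideanSpace ℝ (Fin 3))}
    (hF : F = ((((Fintype.piFinset fun _ : Fin 3 => Finset.Icc (-4 : ℤ) 4).filter
      fun w => (w 0 + w 1 + w 2) % 2 = 0).image P : Finset (EuclideanSpace ℝ (Fin 3))) :
        Set (EuclideanSpace ℝ (Fin 3))))
    (v : Fin 3 → ℤ) (hv : (v 0 + v 1 + v 2) % 2 = 0) (hv3 : ∀ i, -3 ≤ v i ∧ v i ≤ 3) :
    sInf ((fun z => dist z (P v)) '' (F \ {P v})) = Real.sqrt 1250 ∧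
      {z : EuclideanSpace ℝ (Fin 3) | z ∈ F ∧ z ≠ P v ∧ dist z (P v) < 13 / 10 * Real.sqrt 1250} =
        ((fccInt.image fun w : Fin 3 → ℤ => P (v + w) : Finset (EuclideanSpace ℝ (Fin 3))) :
          Set (EuclideanSpace ℝ (Fin 3))) := by
  -- the full lattice and its relation to the chunk
  have hS : {p : EuclideanSpace ℝ (Fin 3) | ∃ w : Fin 3 → ℤ, (w 0 + w 1 + w 2) % 2 = 0 ∧ P w = p} =
      {p | ∃ w : Fin 3 → ℤ, (w 0 + w 1 + w 2) % 2 = 0 ∧ P w = p} := rfl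
  have hmemF : ∀ w : Fin 3 → ℤ, (w 0 + w 1 + w 2) % 2 = 0 → (∀ i, -4 ≤ w i ∧ w i ≤ 4) → P w ∈ F := by
    intro w hw hw4
    rw [hF, Finset.coe_image]
    refine ⟨w, ?_, rfl⟩
    rw [Finset.coe_filter, Set.mem_setOf_eq, Fintype.mem_piFinset]
    exact ⟨fun i => Finset.mem_Icc.2 (hw4 i), hw⟩
  have hFS : ∀ z ∈ F, ∃ w : Fin 3 → ℤ, (w 0 + w 1 + w 2) % 2 = 0 ∧ P w = z := by
    intro z hz
    rw [hF, Finset.coe_image] at hz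
    obtain ⟨w, hw, rfl⟩ := hz
    rw [Finset.coe_filter, Set.mem_setOf_eq] at hw
    exact ⟨w, hw.2, rfl⟩
  have v0 := hv3 0
  have v1 := hv3 1
  have v2 := hv3 2
  -- (a) nearest-neighbour distance
  have ha : sInf ((fun z => dist z (P v)) '' (F \ {P v})) = Real.sqrt 1250 := by
    apply IsLeast.csInf_eq
    constructor
    · refine ⟨P (v + ![1, 1, 0]), ⟨hmemF _ ?_ ?_, ?_⟩, ?_⟩
      · simp only [Pi.add_apply, Matrix.cons_val_zero, Matrix.cons_val_one, Matrix.cons_val]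
        omega
      · intro i
        fin_cases i <;> simp <;> omega
      · intro h
        have h' := bct_label_eq hP (Set.mem_singleton_iff.1 h)
        have := congrFun h' 0
        simp at this
      · show dist _ _ = _
        rw [bct_dist hP _ _ (![1, 1, 0]) (by simp)]
        congr 1
    · rintro _ ⟨z, ⟨hz, hne⟩, rfl⟩
      obtain ⟨w, hw, rfl⟩ := hFS z hz
      show Real.sqrt 1250 ≤ dist _ _
      rw [bct_dist hP w v (w - v) rfl]
      have hne' : w - v ≠ 0 := by
        intro h
        rw [sub_eq_zero] at h
        exact hne (by rw [h]; rfl)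
      have hpar : ((w - v) 0 + (w - v) 1 + (w - v) 2) % 2 = 0 := by
        simp only [Pi.sub_apply]
        omega
      have := bctQ_ge (w - v) hpar hne'
      have h' : (1250 : ℝ) ≤
          ((625 * (w - v) 0 ^ 2 + 625 * (w - v) 1 ^ 2 + 729 * (w - v) 2 ^ 2 : ℤ) : ℝ) := by
        exact_mod_cast this
      exact Real.sqrt_le_sqrt h'
  refine ⟨ha, ?_⟩
  -- (b) the shell: intersect the lattice shell with the chunk
  have hshellS := bct_shell_eq hP hS v hv
  ext z
  constructor
  · rintro ⟨hz, hne, hdist⟩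
    obtain ⟨w, hw, rfl⟩ := hFS z hz
    have : P w ∈ {z : EuclideanSpace ℝ (Fin 3) | z ∈ {p : EuclideanSpace ℝ (Fin 3) |
        ∃ w : Fin 3 → ℤ, (w 0 + w 1 + w 2) % 2 = 0 ∧ P w = p} ∧ z ≠ P v ∧
        dist z (P v) < 13 / 10 * Real.sqrt 1250} := ⟨⟨w, hw, rfl⟩, hne, hdist⟩
    rwa [hshellS] at this
  · intro hz
    have hz' := hz
    rw [← hshellS] at hz'
    obtain ⟨-, hne, hdist⟩ := hz'
    refine ⟨?_, hne, hdist⟩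
    rw [Finset.coe_image] at hz
    obtain ⟨w, hw, rfl⟩ := hz
    have hwb := fccInt_coord_bound w (Finset.mem_coe.1 hw)
    obtain ⟨hpar, -, -⟩ := fccInt_bct_facts w (Finset.mem_coe.1 hw)
    refine hmemF _ ?_ ?_
    · simp only [Pi.add_apply]
      omega
    · intro i
      have := hwb i
      have := hv3 i
      simp only [Pi.add_apply]
      omega

/-- **A finite witness (registered sub-goal).** There is a finite injective configuration
`x : Fin N → ℝ³` (the chunk of the `27/25` bct stretch of fcc with labels in `[-4,4]³`) and a
particle `i` (the centre) that is radially tight two shells deep — verbatim the registered two-shell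
predicate of `stub_twoShellSpread` / `stub_orientationalOrder` with `Set.range (x N)` ↦ `Set.range x`
— and yet NOT `SiteGood`.  So even restricted to finite configurations, the pointwise implication
behind `stub_orientationalOrder` fails at the route's constants; only the ground-state hypothesis
can carry the stub. [folklore] -/
theorem exists_finite_twoShellTight_not_siteGood : ∃ (N : ℕ) (x : Fin N → EuclideanSpace ℝ (Fin 3)), Function.Injective x ∧ ∃ i : Fin N, ((Nat.card ↥{w : EuclideanSpace ℝ (Fin 3) | w ∈ Set.range x ∧ w ≠ (x i) ∧ dist w (x i) < 13 / 10 * sInf ((fun w => dist w (x i)) '' (Set.range x \ {(x i)}))} = 12 ∧ ∀ w ∈ {w : EuclideanSpace ℝ (Fin 3) | w ∈ Set.range x ∧ w ≠ (x i) ∧ dist w (x i) < 13 / 10 * sInf ((fun w => dist w (x i)) '' (Set.range x \ {(x i)}))}, dist w (x i) ≤ 21 / 20 * sInf ((fun w => dist w (x i)) '' (Set.range x \ {(x i)}))) ∧ ∀ z ∈ Set.range x, dist z (x i) < 13 / 5 * sInf ((fun w => dist w (x i)) '' (Set.range x \ {(x i)})) → (Nat.card ↥{w : EuclideanSpace ℝ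 (Fin 3) | w ∈ Set.range x ∧ w ≠ z ∧ dist w z < 13 / 10 * sInf ((fun w => dist w z) '' (Set.range x \ {z}))} = 12 ∧ ∀ w ∈ {w : EuclideanSpace ℝ (Fin 3) | w ∈ Set.range x ∧ w ≠ z ∧ dist w z < 13 / 10 * sInf ((fun w => dist w z) '' (Set.range x \ {z}))}, dist w z ≤ 21 / 20 * sInf ((fun w => dist w z) '' (Set.range x \ {z})))) ∧ ¬ SiteGood (Set.range x) (x i) := by
  classical
  -- the site map, the chunk, its enumeration
  set P : (Fin 3 → ℤ) → EuclideanSpace ℝ (Fin 3) :=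
    fun w => intVec ![25 * w 0, 25 * w 1, 27 * w 2] with hPdef
  have hP : ∀ w, P w = intVec ![25 * w 0, 25 * w 1, 27 * w 2] := fun w => rfl
  set Fs : Finset (EuclideanSpace ℝ (Fin 3)) :=
    ((Fintype.piFinset fun _ : Fin 3 => Finset.Icc (-4 : ℤ) 4).filter
      fun w => (w 0 + w 1 + w 2) % 2 = 0).image P with hFs
  have hF : (Fs : Set (EuclideanSpace ℝ (Fin 3))) =
      ((((Fintype.piFinset fun _ : Fin 3 => Finset.Icc (-4 : ℤ) 4).filter
        fun w => (w 0 + w 1 + w 2) % 2 = 0).image P : Finset (EuclideanSpace ℝ (Fin 3))) :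
          Set (EuclideanSpace ℝ (Fin 3))) := rfl
  have h0mem : P 0 ∈ Fs := by
    refine Finset.mem_image.2 ⟨0, ?_, rfl⟩
    rw [Finset.mem_filter, Fintype.mem_piFinset]
    exact ⟨fun i => Finset.mem_Icc.2 ⟨by norm_num, by norm_num⟩, by simp⟩
  let e := Fs.equivFin
  refine ⟨Fs.card, fun i => ((e.symm i : ↥Fs) : EuclideanSpace ℝ (Fin 3)), ?_, e ⟨P 0, h0mem⟩, ?_⟩
  · exact Subtype.val_injective.comp e.symm.injective
  have hrange : Set.range (fun i => ((e.symm i : ↥Fs) : EuclideanSpace ℝ (Fin 3))) =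
      (Fs : Set (EuclideanSpace ℝ (Fin 3))) := by
    ext z
    constructor
    · rintro ⟨i, rfl⟩
      exact (e.symm i).2
    · intro hz
      exact ⟨e ⟨z, hz⟩, by simp⟩
  have hcentre : ((e.symm (e ⟨P 0, h0mem⟩) : ↥Fs) : EuclideanSpace ℝ (Fin 3)) = P 0 := by simp
  beta_reduce
  rw [hcentre, hrange]
  -- local data at the centre and at every site within 13/5 · d of it
  have hloc0 := bct_chunk_local hP hF 0 (by simp) (fun i => by simp)
  refine ⟨⟨?_, ?_⟩, ?_⟩
  · -- radial tightness at the centre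
    rw [hloc0.1, hloc0.2]
    refine ⟨bct_shell_card hP 0, ?_⟩
    intro z hz
    obtain ⟨w, hw, rfl⟩ : ∃ w ∈ fccInt, P (0 + w) = z := by simpa using hz
    obtain ⟨-, -, hQ⟩ := fccInt_bct_facts w hw
    rw [bct_dist hP (0 + w) 0 w (by simp)]
    exact sqrt_le_slack _ hQ
  · -- radial tightness at every site within 13/5 · d of the centre
    intro z hz hdist
    rw [hloc0.1] at hdist
    rw [hF, Finset.coe_image] at hz
    obtain ⟨v, hv, rfl⟩ := hz
    rw [Finset.coe_filter, Set.mem_setOf_eq, Fintype.mem_piFinset] at hv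
    have hv3 : ∀ i, -3 ≤ v i ∧ v i ≤ 3 := by
      rw [bct_dist hP v 0 v (sub_zero v)] at hdist
      have hQ := lt_of_sqrt_lt_twoShell _ (by positivity) hdist
      intro i
      constructor
      · by_contra h
        push Not at h
        have : 16 ≤ v i ^ 2 := by nlinarith
        fin_cases i <;> simp at this <;> nlinarith [sq_nonneg (v 0), sq_nonneg (v 1), sq_nonneg (v 2)]
      · by_contra h
        push Not at h
        have : 16 ≤ v i ^ 2 := by nlinarith
        fin_cases i <;> simp at this <;> nlinarith [sq_nonneg (v 0), sq_nonneg (v 1), sq_nonneg (v 2)]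
    have hloc := bct_chunk_local hP hF v hv.2 hv3
    rw [hloc.1, hloc.2]
    refine ⟨bct_shell_card hP v, ?_⟩
    intro z hz
    obtain ⟨w, hw, rfl⟩ : ∃ w ∈ fccInt, P (v + w) = z := by simpa using hz
    obtain ⟨-, -, hQ⟩ := fccInt_bct_facts w hw
    rw [bct_dist hP (v + w) v w (by simp)]
    exact sqrt_le_slack _ hQ
  · -- not SiteGood: the no-matching lemma at scale √1250 with the twelve-point shell
    intro h
    simp only [SiteGood] at h
    obtain ⟨A, ⟨e', he'⟩ | ⟨e', he'⟩⟩ := h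
    · exact bct_noMatch hP 0 A fccKissingPattern fcc_pair_dichotomy hloc0.1
        (by rw [hloc0.1]; exact hloc0.2) e' he'
    · exact bct_noMatch hP 0 A hcpKissingPattern hcp_pair_dichotomy hloc0.1
        (by rw [hloc0.1]; exact hloc0.2) e' he'

end Summit.AtomisticToContinuum.Crystallization.Theorems.ZeroDefectDensityBirth

end
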